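import Literature.Analysis.InnerProduct.LensSpaceMultiplicity
import Mathlib.Analysis.SpecialFunctions.Trigonometric.Chebyshev.Basic
import Mathlib.RingTheory.PowerSeries.Derivative
import Mathlib.Analysis.SpecialFunctions.Complex.Log
import HarnessLib

/-!
# The spectrum of the three-dimensional lens spaces `L(q; p₁, p₂)`: `dim E_{k(k+2)} = dim H_k^G = (1/q)∑_l (χ_k − χ_{k−2})(g^l)`
# and Ikeda–Yamamoto's generating function `F(z) = (1/q)∑_{l=0}^{q−1}(1−z²)/∏ᵢ(1−γ^{pᵢl}z)(1−γ^{−pᵢl}z)` (Ikeda–Yamamoto 1979 §2–§3)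

Layer `Literature/Analysis/InnerProduct`, namespace `Literature.Analysis.InnerProduct`; the SPECTRAL INPUT of the heat-trace rows on
quotients of `S³` (lane `lit-hodgefound`, prover seat `lit-hodgefound-p06`, generation 43, self-proposed row g43-#2; row g43-#1
`TwistedGaussianSumAsymptotics.lean` is the analytic input). The tree has the ROUND sphere `S³` (`ThreeSphereHeatTraceExpansion.lean`,
multiplicity `(k+1)²` of `k(k+2)`) and `RP³ = S³/{±1}` (`RealProjectiveSpaceHeatTraceExpansion.lean`); this file gives, for EVERY
`q ≥ 1` and weights `p₁, p₂ ∈ ℤ`, the multiplicity of `k(k+2)` on `L(q; p₁, p₂) = S³/G`, `G = ⟨diag(γ^{p₁}, γ^{p₂})⟩ ⊂ U(2)`,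
`γ = e^{2πi/q}`, exactly as Ikeda–Yamamoto compute it. The four DEFINITIONS (the characters `χ_k` of `P_k` and `χ̃_k = χ_k −
χ_{k−2}` of `H_k` on the maximal torus of `U(2)` as functions of `cᵢ = cos φᵢ`, the invariant-monomial count `dim P_k^G`, and
`dim H_k^G = dim P_k^G − dim P_{k−2}^G`) are the companion file `LensSpaceMultiplicity.lean` (imported); THIS file PROVES their printed
properties: the character formula (3.10), the generating function of Theorem 3.2 coefficientwise in `ℝ⟦z⟧`, the closed forms of
`χ̃_k` (generic / isoclinic / `±1`), and the sanity values `S³` (`q = 1`: `(k+1)²`), `RP³` (`q = 2`: `(k+1)²·[k even]`), `dim E₀ = 1`,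
`dim E₃ = 0` for `q ∤ p₁, p₂`. THEOREMS ONLY (no definition, no instance, no notation, no named fact). Mathlib supplies the Chebyshev
polynomials `T`, `U` with `T_n(cos θ) = cos nθ`, `U_n(cos θ)sin θ = sin (n+1)θ`, `U_n(1) = n+1`, `U_n(−1) = (−1)ⁿ(n+1)`, their
recurrence, `2T_{n+2} = U_{n+2} − U_n`; formal power series `ℝ⟦X⟧` with `coeff_mul` (Cauchy product over `antidiagonal`) and the
formal derivative `d⁄dX`; `Finset.Nat.antidiagonal` bookkeeping; `Complex.exp_eq_one_iff` and `geom_sum_eq` for the orthogonality of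
the characters of `ℤ/q`.

## Source, verbatim (held text `paper:doi-10-18910-4811`)

A. Ikeda, Y. Yamamoto, *On the spectra of 3-dimensional lens spaces*, Osaka J. Math. **16** (1979) 447–469. §1 (p0005): "**Corollary
1.4.** Let `(Ẽ_λ)^G` be the space of all `G`-invariant functions of `Ẽ_λ`. Then have `dim E_λ = dim (Ẽ_λ)^G`." §2 (p0005–p0006): "We
denote by `P_k` the space of homogeneous polynomials of degree `k` with respect to `z₀, z₁, …, z_n, z̄₀, z̄₁, …, z̄_n` and `H_k` the
subspace of `P_k` consisting of harmonic polynomials on `ℂ^{n+1}` … **Proposition 2.1.** The space `H_k` is `U(n+1)`-invariant, and the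
`U(n+1)`-module `P_k` has the direct sum decomposition; `P_k = H_k ⊕ r²P_{k−2}`. … **Proposition 2.2.** `ℋ_k` is an eigenspace of `Δ`
on `S^{2n+1}` with eigenvalue `k(k+2n)` … **Corollary 2.3.** Let `L(q : p₀, ⋯, p_n)` be a lens space and `ℋ_k^G` the space of all
`G`-invariant functions in `ℋ_k` where `G = {g^k}_{k=0,1,…,q−1}`. Then we have `dim E_{k(k+2n)} = dim ℋ_k^G`. Moreover, for any integer
`k` such that `dim ℋ_k^G ≠ 0`, `k(k+2n)` is an eigenvalue of `Δ` on `L(q : p₀, ⋯, p_n)` with multiplicity `dim ℋ_k^G` and no other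
eigenvalues appear in the spectrum of `Δ`." §3 (p0006–p0007): "Let `χ_k` (resp. `χ̃_k`) be the character of the `G`-module `P_k`
(resp. `H_k`). Then by Proposition 2.1, we have (3.1) `χ̃_k = χ_k − χ_{k−2}`, where `χ_{−t} = 0` for `t > 0`, since `r²` is invariant
by `G`. The space `P_k` has a base consisting of all monomials of the form (3.2) `z^I·z̄^J = (z₀)^{i₀}⋯(z_n)^{i_n}·(z̄₀)^{j₀}⋯(z̄_n)^{j_n}`
… Let `g` be the generator of `G` and `γ = exp 2π√−1/q`. Then for any monomial `z^I·z̄^J`, we have (3.3) `g(z^I·z̄^J) =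
γ^{i₀p₀+⋯+i_np_n−j₀p₀−⋯−j_np_n}z^I·z̄^J`. Consider the formal expansion of (3.4) `∏_{i=0}^{n}(1 − γ^{p_il}z)^{−1}(1 − γ^{−p_il}z)^{−1}`.
Then it is easy to see that `χ_k(g^l)` is equal to the `z^k`'s coefficient of (3.4). … **Theorem 3.2.** … `F(z)` has the following
form on the domain `{z ∈ ℂ : |z| < 1}` (3.8) `F(z) = (1/q)∑_{l=0}^{q−1} (1−z²)/∏_{i=0}^{n}(z−γ^{p_il})(z−γ^{−p_il})`. *Proof.* By
Corollary 2.3, we have (3.9) `F(z) = ∑_{k=0}^∞ (dim ℋ_k^G)z^k`. On the other hand by Proposition 2.2 and (3.1), we have (3.10)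
`dim ℋ_k^G = (1/q)∑_{l=0}^{q−1}(χ_k(g^l) − χ_{k−2}(g^l))`. Note that, for a nontrivial irreducible representation of `G`, the sum
`∑_{g∈G}χ(g)` of its character is zero." (Here `n + 1 = 2`, `G ⊂ U(2)`, `g^l = diag(γ^{p₁l}, γ^{p₂l})`.)
A. Ikeda, Ann. Sci. ÉNS **13** (1980) (2.3) (held `paper:doi-10-24033-asens-1384` p0010) restates (3.8); E. A. Lauret, R. J. Miatello,
J. P. Rossetti, São Paulo J. Math. Sci. **13** (2019) §2 (held `paper:arxiv-1904.01146` p0004–p0006) derive it from Molien's formula.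

## The dictionary

For the torus element `diag(e^{iφ₁}, e^{iφ₂})` (`φᵢ = 2πpᵢl/q`), (3.3)–(3.4) give `χ_k = ∑_{a+b+c+d=k} e^{i((a−b)φ₁+(c−d)φ₂)} =
∑_{i+j=k} U_i(cos φ₁)U_j(cos φ₂)`, because one factor `(1 − e^{iφ}z)^{−1}(1 − e^{−iφ}z)^{−1} = (1 − 2cos φ·z + z²)^{−1} = ∑_i U_i(cos φ)zⁱ`
(Chebyshev of the second kind; `U_i(cos φ) = ∑_{a+b=i} e^{i(a−b)φ} = ∑_{j≤i} cos((i−2j)φ)`, §2). So we DEFINE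
`χ_k(c₁,c₂) := ∑_{i+j=k} U_i(c₁)U_j(c₂)` (`threeSphereMonomialCharacter`) and `χ̃_k := χ_k − χ_{k−2}` (`threeSphereHarmonicCharacter`)
as polynomial functions of `(c₁, c₂)`, and `dim P_k^G :=` the number of `(a,b,c,d) ∈ ℕ⁴`, `a+b+c+d = k`, with `q ∣ (a−b)p₁ + (c−d)p₂`
(`lensMonomialCount`, by (3.2)–(3.3) and orthogonality), `dim E_{k(k+2)} = dim H_k^G := dim P_k^G − dim P_{k−2}^G` (`lensMultiplicity`,
by Corollary 2.3 and (3.1)). In `ℝ⟦z⟧`: `(1 − 2c₁z + z²)(1 − 2c₂z + z²)∑_k χ̃_k(c₁,c₂)z^k = 1 − z²` (Theorem 3.2 termwise), and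
extracting coefficients: `χ̃_k = (T_{k+1}(c₁) − T_{k+1}(c₂))/(c₁ − c₂)` for `c₁ ≠ c₂` (partial fractions, the two quadratics differ by
`2(c₂−c₁)z`) and `χ̃_k(c,c) = (k+1)U_k(c)` (`(1−z²)/(1−2cz+z²)² = d/dz[z/(1−2cz+z²)]`); in angles: `(cos(k+1)φ₁ − cos(k+1)φ₂)/(cos φ₁ −
cos φ₂)`, `(k+1)sin((k+1)φ)/sin φ`, `(k+1)²` at the identity, `(−1)ᵏ(k+1)²` at `−1`. These three shapes are exactly the weights
`cos(nφ)`, `n·sin(nφ)`, `(−1)ⁿn²` (`n = k+1`) of the twisted Gaussian sums of row g43-#1.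

## What is proved (about `threeSphereMonomialCharacter` `χ_k`, `threeSphereHarmonicCharacter` `χ̃_k`, `lensMonomialCount` `dim P_k^G`,
## `lensMultiplicity` `dim H_k^G` of `LensSpaceMultiplicity.lean`)

* §1 unfolding lemmas, `threeSphereMonomialCharacter_zero/_one`,
  **`lensMonomialCount_le_add_two`** (`dim P_k^G ≤ dim P_{k+2}^G`, multiplication by `z₁z̄₁`), `cast_lensMultiplicity`,
  `threeSphereHarmonicCharacter_eq`.
* §2 **`eval_U_cos_eq_sum_cos`** (`U_n(cos φ) = ∑_{j≤n} cos((n−2j)φ)`), **`threeSphereMonomialCharacter_cos_cos`** (`χ_k` IS the trace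
  on the monomial basis: `∑_{a+b+c+d=k} cos((a−b)φ₁+(c−d)φ₂)`).
* §3 **`sum_range_cos_two_pi_mul_div`** (orthogonality in `ℤ/q`), **`sum_range_threeSphereMonomialCharacter`** (`∑_l χ_k(g^l) =
  q·dim P_k^G`), **`lensMultiplicity_eq_sum_threeSphereHarmonicCharacter`** (THE MULTIPLICITY FORMULA (3.10)).
* §4 **`quadratic_mul_mk_U_eval`** (`(1−2cz+z²)∑U_k(c)z^k = 1`), `mk_threeSphereMonomialCharacter`, `mk_threeSphereHarmonicCharacter`,
  **`quadratic_mul_quadratic_mul_mk_threeSphereHarmonicCharacter`** (THEOREM 3.2 TERMWISE), `coeff_succ_one_sub_X_sq_mul_mk_U_eval`,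
  **`threeSphereHarmonicCharacter_of_ne`** (generic closed form), **`threeSphereHarmonicCharacter_self`** (isoclinic, via `d⁄dX`),
  `threeSphereHarmonicCharacter_cos_cos_of_ne`, `threeSphereHarmonicCharacter_cos_cos_self_mul_sin`,
  `threeSphereHarmonicCharacter_cos_cos_self`, **`threeSphereHarmonicCharacter_one_one`** (`(k+1)²`),
  **`threeSphereHarmonicCharacter_neg_one_neg_one`** (`(−1)ᵏ(k+1)²`).
* §5 **`lensMultiplicity_one_left`** (`S³`: `(k+1)²`), **`lensMultiplicity_two_one_one`** (`RP³`: `(k+1)²·[k even]`),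
  `lensMultiplicity_zero_right` (`dim E₀ = 1`), `lensMultiplicity_one_right` (`dim E₃ = 0` when `q ∤ p₁, p₂`).

## References

* [IkedaYamamoto1979] A. Ikeda, Y. Yamamoto, *On the spectra of 3-dimensional lens spaces*, Osaka J. Math. 16 (1979) 447–469, §1
  Corollary 1.4, §2 Propositions 2.1–2.2, Corollary 2.3, §3 (3.1)–(3.5), Theorem 3.2 (3.8)–(3.10), Corollary 3.4.
* [Ikeda1980] A. Ikeda, *On lens spaces which are isospectral but not isometric*, Ann. Sci. ÉNS (4) 13 (1980) 303–315, §2 (2.1)–(2.3).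
* [LauretMiatelloRossetti2019] E. A. Lauret, R. J. Miatello, J. P. Rossetti, *Recent results on the spectra of lens spaces*, São Paulo
  J. Math. Sci. (2019), §2 (Molien's formula) and Theorem 3.1.
-/

noncomputable section

open Finset Polynomial.Chebyshev PowerSeries

namespace Literature.Analysis.InnerProduct

open _root_.Real

/-! ### §1 Unfolding the definitions of `LensSpaceMultiplicity.lean`; `dim P_k^G ≤ dim P_{k+2}^G` -/

/-- Unfolding `χ̃_{k+2} = χ_{k+2} − χ_k`. [cite: IkedaYamamoto1979, §3 (3.1)] -/
theorem threeSphereHarmonicCharacter_add_two (k : ℕ) (c₁ c₂ : ℝ) :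
    threeSphereHarmonicCharacter (k + 2) c₁ c₂ =
      threeSphereMonomialCharacter (k + 2) c₁ c₂ - threeSphereMonomialCharacter k c₁ c₂ := by
  rw [threeSphereHarmonicCharacter, if_pos (by omega), Nat.add_sub_cancel]

/-- `χ̃_0 = χ_0`. [cite: IkedaYamamoto1979, §3 (3.1)] -/
theorem threeSphereHarmonicCharacter_zero (c₁ c₂ : ℝ) :
    threeSphereHarmonicCharacter 0 c₁ c₂ = threeSphereMonomialCharacter 0 c₁ c₂ := by
  simp [threeSphereHarmonicCharacter]

/-- `χ̃_1 = χ_1`. [cite: IkedaYamamoto1979, §3 (3.1)] -/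
theorem threeSphereHarmonicCharacter_one (c₁ c₂ : ℝ) :
    threeSphereHarmonicCharacter 1 c₁ c₂ = threeSphereMonomialCharacter 1 c₁ c₂ := by
  simp [threeSphereHarmonicCharacter]

/-- `χ_0 = 1` (the constants). [cite: IkedaYamamoto1979, §3 (3.2)] -/
theorem threeSphereMonomialCharacter_zero (c₁ c₂ : ℝ) : threeSphereMonomialCharacter 0 c₁ c₂ = 1 := by
  simp [threeSphereMonomialCharacter]

/-- `χ_1 = 2c₁ + 2c₂` (the four coordinate functions `z₁, z̄₁, z₂, z̄₂`: `e^{±iφ₁}`, `e^{±iφ₂}`). [cite: IkedaYamamoto1979, §3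
(3.2)–(3.3)] -/
theorem threeSphereMonomialCharacter_one (c₁ c₂ : ℝ) : threeSphereMonomialCharacter 1 c₁ c₂ = 2 * c₁ + 2 * c₂ := by
  rw [threeSphereMonomialCharacter, Finset.Nat.sum_antidiagonal_succ]
  simp [add_comm]

/-- Unfolding `dim H_{k+2}^G = dim P_{k+2}^G − dim P_k^G` (truncated subtraction in `ℕ`; see `lensMonomialCount_le_add_two` for
`dim P_k^G ≤ dim P_{k+2}^G`). [cite: IkedaYamamoto1979, §3 (3.1), (3.10)] -/
theorem lensMultiplicity_add_two (q : ℕ) (p₁ p₂ : ℤ) (k : ℕ) :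
    lensMultiplicity q p₁ p₂ (k + 2) = lensMonomialCount q p₁ p₂ (k + 2) - lensMonomialCount q p₁ p₂ k := by
  rw [lensMultiplicity, if_pos (by omega), Nat.add_sub_cancel]

/-- **`dim P_k^G ≤ dim P_{k+2}^G`**: multiplication by `r² = z₁z̄₁ + z₂z̄₂`'s first monomial, `z₁^a z̄₁^b ↦ z₁^{a+1}z̄₁^{b+1}`, injects
the invariant monomials of degree `k` into those of degree `k + 2` (same weight `(a−b)p₁ + (c−d)p₂`). [cite: IkedaYamamoto1979,
Proposition 2.1 (`P_k = H_k ⊕ r²P_{k−2}`)] -/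
theorem lensMonomialCount_le_add_two (q : ℕ) (p₁ p₂ : ℤ) (k : ℕ) :
    lensMonomialCount q p₁ p₂ k ≤ lensMonomialCount q p₁ p₂ (k + 2) := by
  unfold lensMonomialCount
  -- peel `(0, k+2)` and `(1, k+1)` off `antidiagonal (k+2)`
  rw [Finset.Nat.sum_antidiagonal_succ, Finset.Nat.sum_antidiagonal_succ]
  refine le_add_left (le_add_left (Finset.sum_le_sum fun ij _ ↦ ?_))
  -- inner: `antidiagonal (i+2) ⊇ {(a+1, b+1)}`
  dsimp only
  rw [Finset.Nat.sum_antidiagonal_succ, Finset.Nat.sum_antidiagonal_succ']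
  refine le_add_left (le_add_left (le_of_eq (Finset.sum_congr rfl fun ab _ ↦ Finset.sum_congr rfl fun cd _ ↦ ?_)))
  push_cast
  ring_nf

/-- `(dim H_k^G : ℝ) = dim P_k^G − dim P_{k−2}^G` with the convention `dim P_{−1}^G = dim P_{−2}^G = 0`, all `k`.
[cite: IkedaYamamoto1979, §3 (3.1), (3.10)] -/
theorem cast_lensMultiplicity (q : ℕ) (p₁ p₂ : ℤ) (k : ℕ) :
    (lensMultiplicity q p₁ p₂ k : ℝ) =
      (lensMonomialCount q p₁ p₂ k : ℝ) - (if 2 ≤ k then (lensMonomialCount q p₁ p₂ (k - 2) : ℝ) else 0) := by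
  rcases k with _ | _ | k
  · simp [lensMultiplicity]
  · simp [lensMultiplicity]
  · rw [lensMultiplicity_add_two, Nat.cast_sub (lensMonomialCount_le_add_two q p₁ p₂ k), if_pos (by omega),
      show k + 1 + 1 - 2 = k by omega]

/-- `(χ̃_k : ℝ) = χ_k − [k ≥ 2]χ_{k−2}`, all `k`. [cite: IkedaYamamoto1979, §3 (3.1)] -/
theorem threeSphereHarmonicCharacter_eq (k : ℕ) (c₁ c₂ : ℝ) :
    threeSphereHarmonicCharacter k c₁ c₂ =
      threeSphereMonomialCharacter k c₁ c₂ - (if 2 ≤ k then threeSphereMonomialCharacter (k - 2) c₁ c₂ else 0) := rfl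

/-! ### §2 The weights: `U_n(cos φ) = ∑_{j≤n} cos((n−2j)φ)` and `χ_k(cos φ₁, cos φ₂) = ∑_{a+b+c+d=k} cos((a−b)φ₁ + (c−d)φ₂)` -/

/-- **The character of the `(n+1)`-dimensional representation of `SU(2)` / of the monomials `z^az̄^b`, `a + b = n`:
`U_n(cos φ) = ∑_{j=0}^{n} cos((n−2j)φ)`** (the weights `n, n−2, …, −n`). [cite: IkedaYamamoto1979, §3 (3.3)–(3.5) (one factor
`(1−γ^{pl}z)^{−1}(1−γ^{−pl}z)^{−1} = ∑_{a,b} γ^{(a−b)pl}z^{a+b}`)] -/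
theorem eval_U_cos_eq_sum_cos (n : ℕ) (φ : ℝ) :
    (U ℝ n).eval (Real.cos φ) = ∑ j ∈ range (n + 1), Real.cos (((n : ℝ) - 2 * j) * φ) := by
  -- two-step induction
  suffices h : ∀ n : ℕ, (U ℝ n).eval (Real.cos φ) = ∑ j ∈ range (n + 1), Real.cos (((n : ℝ) - 2 * j) * φ) ∧
      (U ℝ (n + 1 : ℕ)).eval (Real.cos φ) = ∑ j ∈ range (n + 2), Real.cos ((((n + 1 : ℕ) : ℝ) - 2 * j) * φ) from (h n).1
  intro n
  induction n with
  | zero =>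
    refine ⟨by simp, ?_⟩
    simp only [Nat.cast_zero, zero_add, Nat.cast_one, U_one, Polynomial.eval_mul, Polynomial.eval_ofNat,
      Polynomial.eval_X, Finset.sum_range_succ, Finset.sum_range_zero, Nat.cast_zero]
    rw [show ((1 : ℝ) - 2 * 0) * φ = φ by ring, show ((1 : ℝ) - 2 * 1) * φ = -φ by ring, Real.cos_neg]
    ring
  | succ n ih =>
    obtain ⟨h0, h1⟩ := ih
    refine ⟨h1, ?_⟩
    -- `U_{n+2} = 2cos φ·U_{n+1} − U_n`
    have hrec : (U ℝ ((n + 1 + 1 : ℕ) : ℤ)).eval (Real.cos φ) =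
        2 * Real.cos φ * (U ℝ ((n + 1 : ℕ) : ℤ)).eval (Real.cos φ) - (U ℝ (n : ℤ)).eval (Real.cos φ) := by
      have e : ((n + 1 + 1 : ℕ) : ℤ) = (n : ℤ) + 2 := by push_cast; ring
      have e1 : ((n + 1 : ℕ) : ℤ) = (n : ℤ) + 1 := by push_cast; ring
      rw [e, e1, U_add_two]
      simp
    rw [hrec, h1, h0, Finset.mul_sum]
    -- `2cos φ cos(mφ) = cos((m+1)φ) + cos((m−1)φ)`
    have hprod : ∀ j : ℕ, 2 * Real.cos φ * Real.cos ((((n + 1 : ℕ) : ℝ) - 2 * j) * φ) =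
        Real.cos ((((n + 1 + 1 : ℕ) : ℝ) - 2 * j) * φ) + Real.cos (((n : ℝ) - 2 * j) * φ) := by
      intro j
      have e1 : (((n + 1 + 1 : ℕ) : ℝ) - 2 * j) * φ = (((n + 1 : ℕ) : ℝ) - 2 * j) * φ + φ := by push_cast; ring
      have e2 : ((n : ℝ) - 2 * j) * φ = (((n + 1 : ℕ) : ℝ) - 2 * j) * φ - φ := by push_cast; ring
      rw [e1, e2, Real.cos_add, Real.cos_sub]
      ring
    simp only [hprod, Finset.sum_add_distrib]
    -- regroup the last terms
    rw [Finset.sum_range_succ (fun j ↦ Real.cos (((n : ℝ) - 2 * j) * φ)) (n + 1),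
      Finset.sum_range_succ (fun j ↦ Real.cos ((((n + 1 + 1 : ℕ) : ℝ) - 2 * j) * φ)) (n + 2)]
    have e : Real.cos (((n : ℝ) - 2 * ((n + 1 : ℕ) : ℝ)) * φ) = Real.cos ((((n + 1 + 1 : ℕ) : ℝ) - 2 * ((n + 2 : ℕ) : ℝ)) * φ) := by
      congr 1; push_cast; ring
    rw [e]
    ring

/-- The sine weights cancel: `∑_{j=0}^{n} sin((n−2j)φ) = 0` (the reflection `j ↦ n − j`). [folklore] -/
private theorem sum_range_sin_sub_two_mul_aux (n : ℕ) (φ : ℝ) :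
    ∑ j ∈ range (n + 1), Real.sin (((n : ℝ) - 2 * j) * φ) = 0 := by
  have h := Finset.sum_range_reflect (fun j ↦ Real.sin (((n : ℝ) - 2 * j) * φ)) (n + 1)
  have h2 : ∑ j ∈ range (n + 1), Real.sin (((n : ℝ) - 2 * ((n + 1 - 1 - j : ℕ) : ℝ)) * φ) =
      -∑ j ∈ range (n + 1), Real.sin (((n : ℝ) - 2 * j) * φ) := by
    rw [← Finset.sum_neg_distrib]
    refine Finset.sum_congr rfl fun j hj ↦ ?_
    have hj' : j ≤ n := Nat.lt_succ_iff.mp (Finset.mem_range.mp hj)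
    rw [show n + 1 - 1 - j = n - j by omega, Nat.cast_sub hj', ← Real.sin_neg]
    congr 1
    ring
  rw [h2] at h
  linarith

/-- The antidiagonal sum of a function of `a − b` as a sum over `a`: `∑_{a+b=i} g(a−b) = ∑_{a≤i} g(2a−i)`. [folklore] -/
private theorem sum_antidiagonal_cast_sub_aux (i : ℕ) (g : ℝ → ℝ) :
    ∑ ab ∈ antidiagonal i, g ((ab.1 : ℝ) - ab.2) = ∑ a ∈ range (i + 1), g (2 * a - i) := by
  rw [Finset.Nat.sum_antidiagonal_eq_sum_range_succ_mk]
  refine Finset.sum_congr rfl fun a ha ↦ ?_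
  have ha' : a ≤ i := Nat.lt_succ_iff.mp (Finset.mem_range.mp ha)
  dsimp only
  rw [Nat.cast_sub ha']
  congr 1
  ring

/-- **`χ_k` IS THE CHARACTER OF THE MONOMIALS: `∑_{i+j=k} U_i(cos φ₁)U_j(cos φ₂) = ∑_{a+b+c+d=k} cos((a−b)φ₁ + (c−d)φ₂)`** — the
trace of `diag(e^{iφ₁}, e^{iφ₂})` on `P_k` in the monomial basis `z₁^a z̄₁^b z₂^c z̄₂^d` ("`g(z^I z̄^J) = γ^{(i₀−j₀)p₀ + (i₁−j₁)p₁}z^I z̄^J`").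
[cite: IkedaYamamoto1979, §3 (3.2)–(3.4)] -/
theorem threeSphereMonomialCharacter_cos_cos (k : ℕ) (φ₁ φ₂ : ℝ) :
    threeSphereMonomialCharacter k (Real.cos φ₁) (Real.cos φ₂) =
      ∑ ij ∈ antidiagonal k, ∑ ab ∈ antidiagonal ij.1, ∑ cd ∈ antidiagonal ij.2,
        Real.cos (((ab.1 : ℝ) - ab.2) * φ₁ + ((cd.1 : ℝ) - cd.2) * φ₂) := by
  unfold threeSphereMonomialCharacter
  refine Finset.sum_congr rfl fun ij _ ↦ ?_
  obtain ⟨i, j⟩ := ij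
  dsimp only
  rw [eval_U_cos_eq_sum_cos, eval_U_cos_eq_sum_cos]
  -- rewrite the antidiagonal sums as range sums
  have hR : ∑ ab ∈ antidiagonal i, ∑ cd ∈ antidiagonal j, Real.cos (((ab.1 : ℝ) - ab.2) * φ₁ + ((cd.1 : ℝ) - cd.2) * φ₂) =
      ∑ a ∈ range (i + 1), ∑ c ∈ range (j + 1), Real.cos (((i : ℝ) - 2 * a) * φ₁ + ((j : ℝ) - 2 * c) * φ₂) := by
    rw [sum_antidiagonal_cast_sub_aux i (fun x ↦ ∑ cd ∈ antidiagonal j, Real.cos (x * φ₁ + ((cd.1 : ℝ) - cd.2) * φ₂))]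
    refine Finset.sum_congr rfl fun a _ ↦ ?_
    rw [sum_antidiagonal_cast_sub_aux j (fun y ↦ Real.cos ((2 * (a : ℝ) - i) * φ₁ + y * φ₂))]
    refine Finset.sum_congr rfl fun c _ ↦ ?_
    rw [← Real.cos_neg]
    congr 1
    ring
  rw [hR]
  simp_rw [Real.cos_add, Finset.sum_sub_distrib, ← Finset.mul_sum, ← Finset.sum_mul,
    sum_range_sin_sub_two_mul_aux, zero_mul, sub_zero]

/-! ### §3 Character orthogonality and the multiplicity formula `dim H_k^G = (1/q)∑_{l<q}(χ_k(g^l) − χ_{k−2}(g^l))` -/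

/-- **Orthogonality of the characters of `ℤ/q`**: `∑_{l=0}^{q−1} cos(2πlM/q) = q` if `q ∣ M` and `0` otherwise (`q ≥ 1`, `M ∈ ℤ`)
("for a nontrivial irreducible representation of `G`, the sum `∑ χ(g)` of its character is zero"). [cite: IkedaYamamoto1979, proof
of Theorem 3.2 (after (3.10))] -/
theorem sum_range_cos_two_pi_mul_div (q : ℕ) (hq : q ≠ 0) (M : ℤ) :
    ∑ l ∈ range q, Real.cos (2 * π * l * M / q) = if (q : ℤ) ∣ M then (q : ℝ) else 0 := by
  have hq' : (q : ℂ) ≠ 0 := Nat.cast_ne_zero.mpr hq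
  set ζ : ℂ := Complex.exp (((2 * π * M / q : ℝ) : ℂ) * Complex.I) with hζ
  have hpow : ∀ l : ℕ, ζ ^ l = Complex.exp (((2 * π * l * M / q : ℝ) : ℂ) * Complex.I) := by
    intro l
    rw [hζ, ← Complex.exp_nat_mul]
    congr 1
    push_cast
    ring
  have hre : ∀ l : ℕ, Real.cos (2 * π * l * M / q) = (ζ ^ l).re := by
    intro l
    rw [hpow, Complex.exp_ofReal_mul_I_re]
  simp_rw [hre, ← Complex.re_sum]
  split_ifs with hdvd
  · obtain ⟨m, hm⟩ := hdvd
    have h1 : ζ = 1 := by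
      rw [hζ, hm]
      have e : (((2 * π * ((q * m : ℤ) : ℝ) / q : ℝ)) : ℂ) * Complex.I = (m : ℂ) * (2 * π * Complex.I) := by
        push_cast
        field_simp
      rw [e]
      exact Complex.exp_int_mul_two_pi_mul_I m
    simp [h1]
  · have h1 : ζ ≠ 1 := by
      intro h
      rw [hζ, Complex.exp_eq_one_iff] at h
      obtain ⟨m, hm⟩ := h
      apply hdvd
      refine ⟨m, ?_⟩
      have hπ : (π : ℂ) ≠ 0 := Complex.ofReal_ne_zero.mpr Real.pi_ne_zero
      have e : ((M : ℝ) : ℂ) = ((q * m : ℤ) : ℂ) := by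
        push_cast at hm ⊢
        field_simp at hm
        linear_combination hm
      exact_mod_cast e
    have hq1 : ζ ^ q = 1 := by
      rw [hpow]
      have e : (((2 * π * (q : ℕ) * M / q : ℝ)) : ℂ) * Complex.I = (M : ℂ) * (2 * π * Complex.I) := by
        push_cast
        field_simp
      rw [e]
      exact Complex.exp_int_mul_two_pi_mul_I M
    rw [geom_sum_eq h1, hq1, sub_self, zero_div, Complex.zero_re]

/-- **`∑_{l<q} χ_k(g^l) = q·dim P_k^G`** for `L(q; p₁, p₂)` (`g^l = diag(γ^{lp₁}, γ^{lp₂})`, `γ = e^{2πi/q}`): the monomial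
`z₁^a z̄₁^b z₂^c z̄₂^d` contributes `∑_l γ^{l((a−b)p₁+(c−d)p₂)} = q·[q ∣ (a−b)p₁+(c−d)p₂]`. [cite: IkedaYamamoto1979, §3 (3.3) and the
proof of Theorem 3.2] -/
theorem sum_range_threeSphereMonomialCharacter (q : ℕ) (hq : q ≠ 0) (p₁ p₂ : ℤ) (k : ℕ) :
    ∑ l ∈ range q, threeSphereMonomialCharacter k (Real.cos (2 * π * l * p₁ / q)) (Real.cos (2 * π * l * p₂ / q)) =
      (q : ℝ) * lensMonomialCount q p₁ p₂ k := by
  simp_rw [threeSphereMonomialCharacter_cos_cos]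
  rw [Finset.sum_comm]
  unfold lensMonomialCount
  push_cast
  rw [Finset.mul_sum]
  refine Finset.sum_congr rfl fun ij _ ↦ ?_
  rw [Finset.sum_comm, Finset.mul_sum]
  refine Finset.sum_congr rfl fun ab _ ↦ ?_
  rw [Finset.sum_comm, Finset.mul_sum]
  refine Finset.sum_congr rfl fun cd _ ↦ ?_
  have e : ∀ l : ℕ, Real.cos (((ab.1 : ℝ) - ab.2) * (2 * π * l * p₁ / q) + ((cd.1 : ℝ) - cd.2) * (2 * π * l * p₂ / q)) =
      Real.cos (2 * π * l * ((((ab.1 : ℤ) - ab.2) * p₁ + ((cd.1 : ℤ) - cd.2) * p₂ : ℤ) : ℝ) / q) := by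
    intro l
    congr 1
    push_cast
    ring
  simp_rw [e]
  rw [sum_range_cos_two_pi_mul_div q hq]
  split_ifs <;> simp

/-- **THE MULTIPLICITY FORMULA (3.10): `dim E_{k(k+2)}(L(q;p₁,p₂)) = dim H_k^G = (1/q)∑_{l=0}^{q−1}(χ_k(g^l) − χ_{k−2}(g^l))`** with
`χ_k(g^l) − χ_{k−2}(g^l) = χ̃_k(cos(2πlp₁/q), cos(2πlp₂/q))` the character of the harmonic polynomials. [cite: IkedaYamamoto1979,
Corollary 2.3 and §3 (3.10)] -/
theorem lensMultiplicity_eq_sum_threeSphereHarmonicCharacter (q : ℕ) (hq : q ≠ 0) (p₁ p₂ : ℤ) (k : ℕ) :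
    (lensMultiplicity q p₁ p₂ k : ℝ) =
      1 / q * ∑ l ∈ range q, threeSphereHarmonicCharacter k (Real.cos (2 * π * l * p₁ / q)) (Real.cos (2 * π * l * p₂ / q)) := by
  have hq' : (q : ℝ) ≠ 0 := Nat.cast_ne_zero.mpr hq
  rw [cast_lensMultiplicity]
  simp_rw [threeSphereHarmonicCharacter_eq]
  rw [Finset.sum_sub_distrib, sum_range_threeSphereMonomialCharacter q hq]
  split_ifs with hk
  · rw [sum_range_threeSphereMonomialCharacter q hq]
    field_simp
  · simp only [Finset.sum_const_zero, sub_zero]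
    field_simp

/-! ### §4 Ikeda–Yamamoto's generating function: `∑_k χ̃_k z^k·(1 − 2c₁z + z²)(1 − 2c₂z + z²) = 1 − z²` and the closed forms -/

/-- **`(1 − 2cz + z²)·∑_k U_k(c)z^k = 1`** in `ℝ⟦z⟧`: the generating function of the Chebyshev polynomials of the second kind, i.e.
`(1 − e^{iφ}z)^{−1}(1 − e^{−iφ}z)^{−1} = ∑ U_k(cos φ)z^k` ("the above power series converges to the function `∏(1−γ^{p_il}z)^{−1}
(1−γ^{−p_il}z)^{−1}`"). [cite: IkedaYamamoto1979, §3 (3.4)–(3.5)] -/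
theorem quadratic_mul_mk_U_eval (c : ℝ) :
    ((1 : ℝ⟦X⟧) - C (2 * c) * X + X ^ 2) * PowerSeries.mk (fun k : ℕ ↦ (U ℝ k).eval c) = 1 := by
  ext n
  rw [add_mul, sub_mul, one_mul, map_add, map_sub, mul_assoc, coeff_C_mul, coeff_X_pow_mul', coeff_one, coeff_mk]
  rcases n with _ | _ | n
  · simp
  · simp [coeff_succ_X_mul, coeff_mk]
  · rw [coeff_succ_X_mul, coeff_mk, if_pos (by omega), if_neg (by omega), show n + 1 + 1 - 2 = n by omega]
    have e : ((n + 1 + 1 : ℕ) : ℤ) = (n : ℤ) + 2 := by push_cast; ring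
    have e1 : ((n + 1 : ℕ) : ℤ) = (n : ℤ) + 1 := by push_cast; ring
    rw [e, e1, U_add_two]
    simp

/-- `∑_k χ_k z^k = (∑ U_i(c₁)zⁱ)(∑ U_j(c₂)zʲ)` (Cauchy product). [cite: IkedaYamamoto1979, §3 (3.4)–(3.5)] -/
theorem mk_threeSphereMonomialCharacter (c₁ c₂ : ℝ) :
    PowerSeries.mk (fun k : ℕ ↦ threeSphereMonomialCharacter k c₁ c₂) =
      PowerSeries.mk (fun k : ℕ ↦ (U ℝ k).eval c₁) * PowerSeries.mk (fun k : ℕ ↦ (U ℝ k).eval c₂) := by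
  ext n
  rw [coeff_mk, coeff_mul, threeSphereMonomialCharacter]
  simp only [coeff_mk]

/-- `∑_k χ̃_k z^k = (1 − z²)(∑ U_i(c₁)zⁱ)(∑ U_j(c₂)zʲ)`. [cite: IkedaYamamoto1979, §3 (3.1), (3.4)–(3.5)] -/
theorem mk_threeSphereHarmonicCharacter (c₁ c₂ : ℝ) :
    PowerSeries.mk (fun k : ℕ ↦ threeSphereHarmonicCharacter k c₁ c₂) =
      ((1 : ℝ⟦X⟧) - X ^ 2) * (PowerSeries.mk (fun k : ℕ ↦ (U ℝ k).eval c₁) * PowerSeries.mk (fun k : ℕ ↦ (U ℝ k).eval c₂)) := by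
  rw [← mk_threeSphereMonomialCharacter]
  ext n
  rw [coeff_mk, sub_mul, one_mul, map_sub, coeff_mk, coeff_X_pow_mul', threeSphereHarmonicCharacter_eq]
  split_ifs <;> simp [coeff_mk]

/-- **IKEDA–YAMAMOTO'S GENERATING FUNCTION, THEOREM 3.2 FOR `n + 1 = 2`, TERM BY TERM: `(1 − 2c₁z + z²)(1 − 2c₂z + z²)·∑_k χ̃_k(c₁,c₂)z^k
= 1 − z²`** in `ℝ⟦z⟧`, i.e. `∑_k (χ_k(g^l) − χ_{k−2}(g^l))z^k = (1 − z²)/∏_{i=1,2}(1 − γ^{p_il}z)(1 − γ^{−p_il}z)` with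
`(1 − γ^{pl}z)(1 − γ^{−pl}z) = 1 − 2cos(2πpl/q)z + z²`; averaging over `l` gives `F(z) = ∑(dim E_{k(k+2)})z^k =
(1/q)∑_l (1−z²)/∏ᵢ(z−γ^{p_il})(z−γ^{−p_il})` (§3 `lensMultiplicity_eq_sum_threeSphereHarmonicCharacter`). [cite: IkedaYamamoto1979,
Theorem 3.2 (3.8) with (3.5), (3.9), (3.10)] -/
theorem quadratic_mul_quadratic_mul_mk_threeSphereHarmonicCharacter (c₁ c₂ : ℝ) :
    ((1 : ℝ⟦X⟧) - C (2 * c₁) * X + X ^ 2) * ((1 : ℝ⟦X⟧) - C (2 * c₂) * X + X ^ 2) *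
      PowerSeries.mk (fun k : ℕ ↦ threeSphereHarmonicCharacter k c₁ c₂) = 1 - X ^ 2 := by
  rw [mk_threeSphereHarmonicCharacter]
  have h1 := quadratic_mul_mk_U_eval c₁
  have h2 := quadratic_mul_mk_U_eval c₂
  calc _ = ((1 : ℝ⟦X⟧) - X ^ 2) * ((((1 : ℝ⟦X⟧) - C (2 * c₁) * X + X ^ 2) * PowerSeries.mk (fun k : ℕ ↦ (U ℝ k).eval c₁)) *
      ((((1 : ℝ⟦X⟧) - C (2 * c₂) * X + X ^ 2) * PowerSeries.mk (fun k : ℕ ↦ (U ℝ k).eval c₂)))) := by ring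
    _ = 1 - X ^ 2 := by rw [h1, h2, mul_one, mul_one]

/-- `[z^{k+1}] (1 − z²)∑U_i(c)zⁱ = 2T_{k+1}(c)` (`U_{k+1} − U_{k−1} = 2T_{k+1}`; `k = 0`: `U_1 = 2c = 2T_1`). [cite: IkedaYamamoto1979, §3
(3.4)–(3.5)] -/
theorem coeff_succ_one_sub_X_sq_mul_mk_U_eval (c : ℝ) (k : ℕ) :
    coeff (k + 1) (((1 : ℝ⟦X⟧) - X ^ 2) * PowerSeries.mk (fun k : ℕ ↦ (U ℝ k).eval c)) = 2 * (T ℝ (k + 1 : ℕ)).eval c := by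
  rw [sub_mul, one_mul, map_sub, coeff_mk, coeff_X_pow_mul']
  rcases k with _ | k
  · simp
  · rw [if_pos (by omega), coeff_mk, show k + 1 + 1 - 2 = k by omega]
    have e : ((k + 1 + 1 : ℕ) : ℤ) = (k : ℤ) + 2 := by push_cast; ring
    have h := congrArg (Polynomial.eval c) (two_mul_T_eq_U_sub_U ℝ (k : ℤ))
    simp only [Polynomial.eval_mul, Polynomial.eval_ofNat, Polynomial.eval_sub] at h
    rw [e]
    exact h.symm

/-- **THE GENERIC CLOSED FORM: `χ̃_k(c₁,c₂) = (T_{k+1}(c₁) − T_{k+1}(c₂))/(c₁ − c₂)` for `c₁ ≠ c₂`** — partial fractions: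
`∑U_i(c₁)zⁱ − ∑U_j(c₂)zʲ = 2(c₁−c₂)z·∑U_i(c₁)zⁱ∑U_j(c₂)zʲ` since the two quadratics differ by `2(c₂−c₁)z`. With `cᵢ = cos φᵢ`:
`(cos((k+1)φ₁) − cos((k+1)φ₂))/(cos φ₁ − cos φ₂)` (`threeSphereHarmonicCharacter_cos_cos_of_ne`). [cite: IkedaYamamoto1979, Theorem
3.2 (3.8) (the simple poles of `F` at `γ^{±p_il}` when `p₁l ≢ ±p₂l`); Ikeda1980, (2.3)] -/
theorem threeSphereHarmonicCharacter_of_ne {c₁ c₂ : ℝ} (h : c₁ ≠ c₂) (k : ℕ) :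
    threeSphereHarmonicCharacter k c₁ c₂ = ((T ℝ (k + 1 : ℕ)).eval c₁ - (T ℝ (k + 1 : ℕ)).eval c₂) / (c₁ - c₂) := by
  set u₁ : ℝ⟦X⟧ := PowerSeries.mk (fun k : ℕ ↦ (U ℝ k).eval c₁) with hu₁
  set u₂ : ℝ⟦X⟧ := PowerSeries.mk (fun k : ℕ ↦ (U ℝ k).eval c₂) with hu₂
  have h1 : ((1 : ℝ⟦X⟧) - C (2 * c₁) * X + X ^ 2) * u₁ = 1 := quadratic_mul_mk_U_eval c₁
  have h2 : ((1 : ℝ⟦X⟧) - C (2 * c₂) * X + X ^ 2) * u₂ = 1 := quadratic_mul_mk_U_eval c₂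
  -- `u₁ − u₂ = u₁u₂(A₂ − A₁) = 2(c₁ − c₂)·X·u₁u₂`
  have hdiff : u₁ - u₂ = C (2 * (c₁ - c₂)) * X * (u₁ * u₂) := by
    calc u₁ - u₂ = u₁ * (((1 : ℝ⟦X⟧) - C (2 * c₂) * X + X ^ 2) * u₂) - (((1 : ℝ⟦X⟧) - C (2 * c₁) * X + X ^ 2) * u₁) * u₂ := by
          rw [h1, h2, mul_one, one_mul]
      _ = (C (2 * c₁) - C (2 * c₂)) * X * (u₁ * u₂) := by ring
      _ = C (2 * (c₁ - c₂)) * X * (u₁ * u₂) := by rw [← map_sub]; ring_nf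
  have hk : coeff (k + 1) (((1 : ℝ⟦X⟧) - X ^ 2) * (u₁ - u₂)) =
      coeff (k + 1) (C (2 * (c₁ - c₂)) * X * (((1 : ℝ⟦X⟧) - X ^ 2) * (u₁ * u₂))) := by
    rw [hdiff]; ring_nf
  rw [mul_sub, map_sub, hu₁, hu₂, coeff_succ_one_sub_X_sq_mul_mk_U_eval, coeff_succ_one_sub_X_sq_mul_mk_U_eval, mul_assoc,
    coeff_C_mul, coeff_succ_X_mul, ← mk_threeSphereHarmonicCharacter, coeff_mk] at hk
  have hne : c₁ - c₂ ≠ 0 := sub_ne_zero.mpr h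
  field_simp
  linarith

/-- `d/dz (1 − 2cz + z²) = −2c + 2z` in `ℝ⟦z⟧`. [folklore] -/
private theorem derivative_quadratic_aux (c : ℝ) :
    d⁄dX ℝ ((1 : ℝ⟦X⟧) - C (2 * c) * X + X ^ 2) = -C (2 * c) + 2 * X := by
  rw [show (2 : ℝ⟦X⟧) * X = C 2 * X by rw [map_ofNat]]
  ext n
  simp only [coeff_derivative, map_add, map_sub, map_neg, coeff_one, coeff_C_mul, coeff_X, coeff_X_pow, coeff_C]
  rcases n with _ | _ | n
  · simp
  · norm_num
  · simp

/-- **THE ISOCLINIC CLOSED FORM: `χ̃_k(c,c) = (k+1)U_k(c)`** — `(1 − z²)/(1 − 2cz + z²)² = d/dz [z/(1 − 2cz + z²)] =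
∑(k+1)U_k(c)z^k`. With `c = cos φ`, `sin φ ≠ 0`: `(k+1)sin((k+1)φ)/sin φ`; `c = 1`: `(k+1)²` (the identity: all of `H_k`); `c = −1`:
`(−1)ᵏ(k+1)²` (the antipodal map). [cite: IkedaYamamoto1979, Theorem 3.2 (3.8) and Corollary 3.4 (the poles of order `n + 1 = 2` of `F`
at `γ^{±pl}` in the homogeneous case `p₁l ≡ ±p₂l`)] -/
theorem threeSphereHarmonicCharacter_self (c : ℝ) (k : ℕ) :
    threeSphereHarmonicCharacter k c c = ((k : ℝ) + 1) * (U ℝ k).eval c := by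
  set A : ℝ⟦X⟧ := (1 : ℝ⟦X⟧) - C (2 * c) * X + X ^ 2 with hA
  set u : ℝ⟦X⟧ := PowerSeries.mk (fun k : ℕ ↦ (U ℝ k).eval c) with hu
  have h1 : A * u = 1 := quadratic_mul_mk_U_eval c
  have hdA : d⁄dX ℝ A = -C (2 * c) + 2 * X := derivative_quadratic_aux c
  -- `A·u' = −u·A'`
  have hder : A * d⁄dX ℝ u + u * d⁄dX ℝ A = 0 := by
    have h := (d⁄dX ℝ).leibniz A u
    rw [h1, Derivation.map_one_eq_zero, smul_eq_mul, smul_eq_mul] at h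
    linear_combination -h
  -- `u' = −u²A'`
  have hdu : d⁄dX ℝ u = -(u * u) * d⁄dX ℝ A := by
    have h := congrArg (fun x ↦ u * x) hder
    simp only [mul_add, mul_zero, ← mul_assoc] at h
    rw [mul_comm u A, h1, one_mul] at h
    linear_combination h
  -- `d/dz (z·u) = (1 − z²)u²`
  have hkey : d⁄dX ℝ (X * u) = ((1 : ℝ⟦X⟧) - X ^ 2) * (u * u) := by
    have h := (d⁄dX ℝ).leibniz X u
    rw [smul_eq_mul, smul_eq_mul, derivative_X, mul_one] at h
    rw [h, hdu, hdA]
    have hu1 : u = u * u * A := by rw [mul_assoc, mul_comm u A, h1, mul_one]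
    calc X * (-(u * u) * (-C (2 * c) + 2 * X)) + u
        = X * (-(u * u) * (-C (2 * c) + 2 * X)) + u * u * A := by rw [← hu1]
      _ = ((1 : ℝ⟦X⟧) - X ^ 2) * (u * u) := by rw [hA]; ring
  have hcoeff := congrArg (coeff k) hkey
  rw [coeff_derivative, coeff_succ_X_mul, hu, coeff_mk, ← hu, ← mk_threeSphereHarmonicCharacter, coeff_mk] at hcoeff
  rw [← hcoeff]
  ring

/-- **TRIGONOMETRIC FORM, GENERIC: `χ̃_k(cos φ₁, cos φ₂) = (cos((k+1)φ₁) − cos((k+1)φ₂))/(cos φ₁ − cos φ₂)`** when `cos φ₁ ≠ cos φ₂`.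
[cite: IkedaYamamoto1979, Theorem 3.2 (3.8); Ikeda1980, (2.3)] -/
theorem threeSphereHarmonicCharacter_cos_cos_of_ne {φ₁ φ₂ : ℝ} (h : Real.cos φ₁ ≠ Real.cos φ₂) (k : ℕ) :
    threeSphereHarmonicCharacter k (Real.cos φ₁) (Real.cos φ₂) =
      (Real.cos (((k : ℝ) + 1) * φ₁) - Real.cos (((k : ℝ) + 1) * φ₂)) / (Real.cos φ₁ - Real.cos φ₂) := by
  rw [threeSphereHarmonicCharacter_of_ne h, T_real_cos, T_real_cos]
  push_cast
  ring_nf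

/-- **TRIGONOMETRIC FORM, ISOCLINIC: `χ̃_k(cos φ, cos φ)·sin φ = (k+1)sin((k+1)φ)`** (so `= (k+1)sin((k+1)φ)/sin φ` off `φ ∈ πℤ`).
[cite: IkedaYamamoto1979, Theorem 3.2 (3.8), Corollary 3.4] -/
theorem threeSphereHarmonicCharacter_cos_cos_self_mul_sin (φ : ℝ) (k : ℕ) :
    threeSphereHarmonicCharacter k (Real.cos φ) (Real.cos φ) * Real.sin φ = ((k : ℝ) + 1) * Real.sin (((k : ℝ) + 1) * φ) := by
  rw [threeSphereHarmonicCharacter_self, mul_assoc, U_real_cos]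
  push_cast
  ring_nf

/-- The same, divided: `χ̃_k(cos φ, cos φ) = (k+1)sin((k+1)φ)/sin φ` for `sin φ ≠ 0`. [cite: IkedaYamamoto1979, Theorem 3.2 (3.8),
Corollary 3.4] -/
theorem threeSphereHarmonicCharacter_cos_cos_self {φ : ℝ} (hφ : Real.sin φ ≠ 0) (k : ℕ) :
    threeSphereHarmonicCharacter k (Real.cos φ) (Real.cos φ) = ((k : ℝ) + 1) * Real.sin (((k : ℝ) + 1) * φ) / Real.sin φ := by
  rw [eq_div_iff hφ, threeSphereHarmonicCharacter_cos_cos_self_mul_sin]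

/-- **THE IDENTITY ELEMENT: `χ̃_k(1,1) = (k+1)² = dim H_k`** (the multiplicity of `k(k+2)` on `S³`). [cite: IkedaYamamoto1979,
Proposition 2.2 (`H_k` is the eigenspace of `k(k+2n)`, here `n = 1`)] -/
theorem threeSphereHarmonicCharacter_one_one (k : ℕ) : threeSphereHarmonicCharacter k 1 1 = ((k : ℝ) + 1) ^ 2 := by
  rw [threeSphereHarmonicCharacter_self, U_eval_one]
  push_cast
  ring

/-- **THE ANTIPODAL MAP: `χ̃_k(−1,−1) = (−1)ᵏ(k+1)²`** (even harmonics are invariant, odd ones anti-invariant: `RP³ = L(2;1,1)`).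
[cite: IkedaYamamoto1979, §3 (3.3) (`γ = −1` for `q = 2`)] -/
theorem threeSphereHarmonicCharacter_neg_one_neg_one (k : ℕ) :
    threeSphereHarmonicCharacter k (-1) (-1) = (-1) ^ k * ((k : ℝ) + 1) ^ 2 := by
  rw [threeSphereHarmonicCharacter_self, U_eval_neg_one, Int.cast_negOnePow_natCast]
  push_cast
  ring

/-! ### §5 Examples: `S³ = L(1;·,·)`, `RP³ = L(2;1,1)`, the constants, and no eigenvalue `3` on a proper lens space -/

/-- **`q = 1` IS THE ROUND SPHERE: `dim E_{k(k+2)}(S³) = (k+1)²`.** [cite: IkedaYamamoto1979, Proposition 2.2, Corollary 2.3] -/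
theorem lensMultiplicity_one_left (p₁ p₂ : ℤ) (k : ℕ) : lensMultiplicity 1 p₁ p₂ k = (k + 1) ^ 2 := by
  have h := lensMultiplicity_eq_sum_threeSphereHarmonicCharacter 1 one_ne_zero p₁ p₂ k
  simp only [Nat.cast_one, div_one, one_mul, Finset.sum_range_one, Nat.cast_zero, mul_zero, zero_mul,
    Real.cos_zero, threeSphereHarmonicCharacter_one_one] at h
  exact_mod_cast h

/-- **`RP³ = L(2;1,1)`: `dim E_{k(k+2)} = (k+1)²` for even `k` and `0` for odd `k`** (`½((k+1)² + (−1)ᵏ(k+1)²)`; the spectrum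
`4j(j+1)` with multiplicity `(2j+1)²`). [cite: IkedaYamamoto1979, Corollary 2.3 and (3.10) with `q = 2`, `γ = −1`] -/
theorem lensMultiplicity_two_one_one (k : ℕ) : lensMultiplicity 2 1 1 k = if Even k then (k + 1) ^ 2 else 0 := by
  have h := lensMultiplicity_eq_sum_threeSphereHarmonicCharacter 2 two_ne_zero 1 1 k
  rw [Finset.sum_range_succ, Finset.sum_range_one] at h
  simp only [Nat.cast_zero, mul_zero, zero_div, Real.cos_zero, Nat.cast_one, mul_one, Int.cast_one,
    Nat.cast_ofNat, threeSphereHarmonicCharacter_one_one] at h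
  rw [show (2 : ℝ) * π / 2 = π by ring, Real.cos_pi, threeSphereHarmonicCharacter_neg_one_neg_one] at h
  split_ifs with hk
  · rw [hk.neg_one_pow] at h
    have e : (lensMultiplicity 2 1 1 k : ℝ) = (((k + 1) ^ 2 : ℕ) : ℝ) := by rw [h]; push_cast; ring
    exact_mod_cast e
  · rw [(Nat.not_even_iff_odd.mp hk).neg_one_pow] at h
    have e : (lensMultiplicity 2 1 1 k : ℝ) = ((0 : ℕ) : ℝ) := by rw [h]; push_cast; ring
    exact_mod_cast e

/-- **The constants: `dim E_0(L(q;p₁,p₂)) = 1`** for every `q ≥ 1` (one zero mode). [cite: IkedaYamamoto1979, Corollary 2.3] -/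
theorem lensMultiplicity_zero_right (q : ℕ) (p₁ p₂ : ℤ) : lensMultiplicity q p₁ p₂ 0 = 1 := by
  rw [lensMultiplicity, if_neg (by omega), Nat.sub_zero]
  unfold lensMonomialCount
  simp only [Finset.Nat.antidiagonal_zero, Finset.sum_singleton]
  simp

/-- **No eigenvalue `3` on a proper lens space: `dim E_3(L(q;p₁,p₂)) = 0`** when `q ∤ p₁`, `q ∤ p₂` (none of the coordinate
functions `z₁, z̄₁, z₂, z̄₂` — weights `±p₁, ±p₂` — is invariant). [cite: IkedaYamamoto1979, Corollary 2.3 and §3 (3.3)] -/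
theorem lensMultiplicity_one_right {q : ℕ} {p₁ p₂ : ℤ} (h₁ : ¬(q : ℤ) ∣ p₁) (h₂ : ¬(q : ℤ) ∣ p₂) :
    lensMultiplicity q p₁ p₂ 1 = 0 := by
  have h₁' : ¬(q : ℤ) ∣ -p₁ := fun h ↦ h₁ (dvd_neg.mp h)
  have h₂' : ¬(q : ℤ) ∣ -p₂ := fun h ↦ h₂ (dvd_neg.mp h)
  rw [lensMultiplicity, if_neg (by omega), Nat.sub_zero]
  simp [lensMonomialCount, Finset.Nat.antidiagonal_succ, h₁, h₂, h₁', h₂']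

end Literature.Analysis.InnerProduct
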